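import Literature.Analysis.Complex.PuncturedPlaneAutomorphisms
import Mathlib.Analysis.Complex.CoveringMap
import Mathlib.Analysis.SpecialFunctions.Complex.Arg
import Mathlib.Analysis.SpecialFunctions.Pow.Complex
import Literature.Topology.PlaneTopology.JordanCurve
import HarnessLib

/-!
# The puncture double covers `y ↦ y² + p` of `ℂ ∖ F` and their end parities

Classical covering-space input for the abc-iut cell's (H1′) argument at `ℂ ∖ F` ([AbsTopIII] Prop 4.2
(i), geometric column): for a finite `F ⊆ ℂ` and `p ∈ F`, the map `y ↦ y² + p` restricts to a connected
double covering `E_p := {y | y² + p ∉ F} → ℂ ∖ F` (Mathlib's `Polynomial.isCoveringMapOn_eval` off the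
critical value `p`).  Its behaviour at the ENDS of `ℂ ∖ F` (the filters `𝓝[≠] q`, `q ∈ F`, and
`cocompact ℂ`, cf. `PuncturedPlaneEnds`) is recorded by the END PARITY

  «`P` is ODD at `l`» :⟺ every `l`-set contains an `l`-set with CONNECTED preimage under `P`

(spelled out, no definition), the topological shadow of «the local monodromy at the puncture is a
transposition» (A. Hatcher, *Algebraic Topology* §1.3; O. Forster, *Lectures on Riemann Surfaces* §5,
the two-sheeted covering defined by `√(z - p)`):

* `PuncturedPlane.odd_comp_homeomorph_iff` — parity is invariant under homeomorphisms of the total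
  space over the base; `PuncturedPlane.odd_comp_of_odd` — parity is transported by a bijection `f` of
  the base along the filters it maps to each other (`f ∘ P` is odd at `L` if `P` is odd at `L'`,
  `f : L' → L`);
* `PuncturedPlane.isCoveringMapOn_sq_add`, `isCoveringMap_sqAddCover`, `finite_preimage_sq_add`,
  `connectedSpace_sqAddCover` — the double cover `E_p → ℂ ∖ F`;
* **`PuncturedPlane.odd_sqAddCover_nhdsNE_self`**, **`odd_sqAddCover_cocompact`**,
  **`not_odd_sqAddCover_nhdsNE_of_ne`** — `E_p → ℂ ∖ F` is odd at `p` and at `∞` and NOT odd at any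
  other point `q ≠ p` (the preimage of a small punctured disc around `q` splits according to the sign
  of `Re(y/√(q - p))`).

No definitions.  [cite: HatcherAT2002, §1.3 p.56–61] [cite: Conway1978, Ch. III §3]
-/

noncomputable section

namespace Literature.Analysis.Complex

namespace PuncturedPlane

open _root_.Filter _root_.Topology _root_.Metric _root_.Bornology _root_.Set _root_.Function
open _root_.Complex (I arg exp)
open scoped _root_.ComplexConjugate

/-! ### §1 End parity: invariance and transport -/

section Parity

variable {E E' : Type*} [TopologicalSpace E] [TopologicalSpace E']

/-- **End parity is invariant under homeomorphisms of the total space.**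
[cite: HatcherAT2002, §1.3 p.61] -/
theorem odd_comp_homeomorph_iff (P : E → ℂ) (k : E' ≃ₜ E) (l : Filter ℂ) :
    (∀ N ∈ l, ∃ N' ∈ l, N' ⊆ N ∧ IsConnected ((P ∘ k) ⁻¹' N')) ↔
      ∀ N ∈ l, ∃ N' ∈ l, N' ⊆ N ∧ IsConnected (P ⁻¹' N') := by
  refine forall₂_congr fun N _ => exists_congr fun N' => and_congr_right fun _ =>
    and_congr_right fun _ => ?_
  rw [Set.preimage_comp]
  exact k.isConnected_preimage

/-- **Transport of end parity along a bijection of the base.**  Let `P : E → ℂ` take values in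
`U ⊆ ℂ`, and let `f, f' : ℂ → ℂ` preserve `U` and be mutually inverse on `U`.  If `f` maps the filter
`L'` into `L`, `f'` maps `L` into `L'` and `U ∈ L`, then: `P` odd at `L'` ⇒ `f ∘ P` odd at `L`.
[cite: HatcherAT2002, §1.3 p.61] -/
theorem odd_comp_of_odd {P : E → ℂ} {U : Set ℂ} {f f' : ℂ → ℂ} {L L' : Filter ℂ}
    (hPU : ∀ e, P e ∈ U) (hfU : MapsTo f U U) (hf'f : ∀ z ∈ U, f' (f z) = z)
    (hff' : ∀ z ∈ U, f (f' z) = z) (hL : Tendsto f L' L) (hL' : Tendsto f' L L') (hUL : U ∈ L)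
    (hodd : ∀ N ∈ L', ∃ N' ∈ L', N' ⊆ N ∧ IsConnected (P ⁻¹' N')) :
    ∀ N ∈ L, ∃ N' ∈ L, N' ⊆ N ∧ IsConnected ((f ∘ P) ⁻¹' N') := by
  intro N hN
  obtain ⟨M', hM', hM'N, hconn⟩ := hodd (f ⁻¹' N) (hL hN)
  refine ⟨U ∩ f' ⁻¹' M', inter_mem hUL (hL' hM'), ?_, ?_⟩
  · rintro z ⟨hzU, hzM'⟩
    have : f (f' z) ∈ N := hM'N hzM'
    rwa [hff' z hzU] at this
  · have heq : (f ∘ P) ⁻¹' (U ∩ f' ⁻¹' M') = P ⁻¹' M' := by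
      ext e
      simp only [mem_preimage, Function.comp_apply, mem_inter_iff]
      constructor
      · rintro ⟨-, h⟩; rwa [hf'f _ (hPU e)] at h
      · intro h; exact ⟨hfU (hPU e), by rwa [hf'f _ (hPU e)]⟩
    rw [heq]; exact hconn

end Parity

/-! ### §2 Annuli `{y | ‖y‖ ∈ S}` are connected -/

/-- For a connected `S ⊆ (0, ∞)`, the "annulus" `{y : ℂ | ‖y‖ ∈ S}` is connected (the image of
`S × ℝ` under `(t, θ) ↦ t·e^{iθ}`). [cite: Conway1978, Ch. II §2] -/
theorem isConnected_setOf_norm_mem {S : Set ℝ} (hS : IsConnected S) (hS0 : S ⊆ Ioi 0) :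
    IsConnected {y : ℂ | ‖y‖ ∈ S} := by
  have himage : (fun x : ℝ × ℝ => (x.1 : ℂ) * exp (x.2 * I)) '' (S ×ˢ (univ : Set ℝ)) =
      {y : ℂ | ‖y‖ ∈ S} := by
    ext y
    simp only [mem_image, mem_prod, mem_univ, and_true, mem_setOf_eq, Prod.exists]
    constructor
    · rintro ⟨t, θ, ht, rfl⟩
      have h0 : 0 < t := hS0 ht
      rw [norm_mul, Complex.norm_exp_ofReal_mul_I, mul_one, Complex.norm_real, Real.norm_eq_abs,
        abs_of_pos h0]
      exact ht
    · intro hy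
      exact ⟨‖y‖, arg y, hy, Complex.norm_mul_exp_arg_mul_I y⟩
  rw [← himage]
  exact (hS.prod isConnected_univ).image _
    ((Complex.continuous_ofReal.comp continuous_fst).mul
      (Complex.continuous_exp.comp ((Complex.continuous_ofReal.comp continuous_snd).mul
        continuous_const))).continuousOn

/-- A punctured disc `{y | 0 < ‖y‖ < s}` is connected. [cite: Conway1978, Ch. II §2] -/
theorem isConnected_puncturedBall {s : ℝ} (hs : 0 < s) : IsConnected {y : ℂ | 0 < ‖y‖ ∧ ‖y‖ < s} :=
  isConnected_setOf_norm_mem (S := Ioo 0 s) (isConnected_Ioo hs) Ioo_subset_Ioi_self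

/-- A subset `A ⊆ T` of `ℂ` is connected as a subset of the subtype `↥T` iff it is connected in `ℂ`.
[folklore] -/
private theorem isConnected_preimage_val_iff {T A : Set ℂ} (hAT : A ⊆ T) :
    IsConnected ((Subtype.val : T → ℂ) ⁻¹' A) ↔ IsConnected A := by
  have himg : (Subtype.val : T → ℂ) '' (Subtype.val ⁻¹' A) = A := by
    rw [Subtype.image_preimage_coe]; exact inter_eq_right.mpr hAT
  constructor
  · intro h; rw [← himg]; exact h.image _ continuous_subtype_val.continuousOn
  · intro h
    refine ⟨?_, (Topology.IsInducing.subtypeVal.isPreconnected_image).mp (himg.symm ▸ h.isPreconnected)⟩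
    obtain ⟨a, ha⟩ := h.nonempty
    exact ⟨⟨a, hAT ha⟩, ha⟩

/-! ### §3 The double cover `y ↦ y² + p` of `ℂ ∖ F` -/

section SqAdd

variable {F : Set ℂ} (hF : F.Finite) {p : ℂ} (hp : p ∈ F)

/-- The fibres of `y ↦ y² + p` have at most two points: `{y | y² = c}` is finite. [folklore] -/
private theorem finite_setOf_sq_eq (c : ℂ) : {y : ℂ | y ^ 2 = c}.Finite := by
  by_cases h : ∃ y₀ : ℂ, y₀ ^ 2 = c
  · obtain ⟨y₀, hy₀⟩ := h
    refine (Set.toFinite ({y₀, -y₀} : Set ℂ)).subset fun y hy => ?_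
    have h2 : y ^ 2 = y₀ ^ 2 := by rw [hy₀]; exact hy
    rcases sq_eq_sq_iff_eq_or_eq_neg.mp h2 with h | h
    · exact Or.inl h
    · exact Or.inr h
  · have : {y : ℂ | y ^ 2 = c} = ∅ := eq_empty_of_forall_notMem fun y hy => h ⟨y, hy⟩
    rw [this]; exact finite_empty

include hF in
/-- The preimage of the finite set `F` under `y ↦ y² + p` is finite. [cite: HatcherAT2002, §1.3 p.56] -/
theorem finite_preimage_sq_add : ((fun y : ℂ => y ^ 2 + p) ⁻¹' F).Finite := by
  have : (fun y : ℂ => y ^ 2 + p) ⁻¹' F = ⋃ q ∈ F, {y : ℂ | y ^ 2 = q - p} := by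
    ext y
    simp only [mem_preimage, mem_iUnion, mem_setOf_eq, exists_prop]
    constructor
    · intro h; exact ⟨_, h, by ring⟩
    · rintro ⟨q, hq, h⟩; rw [h, sub_add_cancel]; exact hq
  rw [this]
  exact hF.biUnion fun q _ => finite_setOf_sq_eq _

include hp in
/-- **`y ↦ y² + p` is a covering map over `ℂ ∖ F`** (`p ∈ F`): a complex polynomial is a covering map
off its critical values (Mathlib `Polynomial.isCoveringMapOn_eval`), and the only critical value of
`y² + p` is `p`. [cite: HatcherAT2002, §1.3 p.56] -/
theorem isCoveringMapOn_sq_add : IsCoveringMapOn (fun y : ℂ => y ^ 2 + p) Fᶜ := by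
  have h := (Polynomial.X ^ 2 + Polynomial.C p : Polynomial ℂ).isCoveringMapOn_eval
  have hfun : (Polynomial.X ^ 2 + Polynomial.C p : Polynomial ℂ).eval = fun y : ℂ => y ^ 2 + p := by
    funext y; simp
  rw [hfun] at h
  refine h.mono fun z hz => ?_
  -- `z ∉ F` is not a critical value: the critical set is `{0}`, with value `p ∈ F`
  rintro ⟨k, hk, rfl⟩
  have hk0 : k = 0 := by
    simp only [Polynomial.derivative_add, Polynomial.derivative_X_pow, Polynomial.derivative_C,
      add_zero, mem_setOf_eq, Polynomial.eval_mul, Polynomial.eval_pow, Polynomial.eval_X,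
      Nat.cast_ofNat] at hk
    simpa using hk
  subst hk0
  exact hz (by simpa using hp)

include hp in
/-- The restriction `E_p = {y | y² + p ∉ F} → ℂ ∖ F` of `y ↦ y² + p` is a covering map.
[cite: HatcherAT2002, §1.3 p.56] -/
theorem isCoveringMap_sqAddCover :
    IsCoveringMap ((Fᶜ).restrictPreimage (fun y : ℂ => y ^ 2 + p)) :=
  (isCoveringMapOn_sq_add hp).isCoveringMap_restrictPreimage

/-- … with finite fibres. [cite: HatcherAT2002, §1.3 p.56] -/
theorem finite_fibre_sqAddCover (x : ↥(Fᶜ : Set ℂ)) :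
    (((Fᶜ).restrictPreimage (fun y : ℂ => y ^ 2 + p)) ⁻¹' {x}).Finite := by
  refine ((finite_setOf_sq_eq ((x : ℂ) - p)).preimage Subtype.val_injective.injOn).subset ?_
  intro y hy
  simp only [mem_preimage, mem_singleton_iff] at hy
  have : (y : ℂ) ^ 2 + p = x := congrArg Subtype.val hy
  show (y : ℂ) ^ 2 = x - p
  rw [← this, add_sub_cancel_right]

include hF in
/-- `E_p = {y | y² + p ∉ F}` is connected (the complement of a finite subset of `ℂ`).
[cite: HatcherAT2002, §1.3 p.56] -/
theorem connectedSpace_sqAddCover : ConnectedSpace ↥((fun y : ℂ => y ^ 2 + p) ⁻¹' Fᶜ) := by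
  rw [Set.preimage_compl]
  exact isConnected_iff_connectedSpace.mp
    (((finite_preimage_sq_add hF).countable.isPathConnected_compl_of_one_lt_rank
      (by rw [Complex.rank_real_complex]; norm_num)).isConnected)

/-! ### §4 End parities of the double cover -/

/-- Points of norm in a suitable range map into a prescribed punctured disc / exterior under
`y ↦ y² + p`: `‖(y² + p) - p‖ = ‖y‖²`. [folklore] -/
private theorem norm_sq_add_sub (y : ℂ) : ‖y ^ 2 + p - p‖ = ‖y‖ ^ 2 := by
  rw [add_sub_cancel_right, norm_pow]

include hF in
/-- **The double cover `E_p → ℂ ∖ F` is ODD at the puncture `p`**: every punctured neighbourhood of `p`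
contains a punctured disc `D*(p, r)`, whose preimage `{y | 0 < ‖y‖ < √r}` is connected.
[cite: HatcherAT2002, §1.3 p.61] -/
theorem odd_sqAddCover_nhdsNE_self : ∀ N ∈ 𝓝[≠] p, ∃ N' ∈ 𝓝[≠] p, N' ⊆ N ∧
    IsConnected ((fun e : ↥((fun y : ℂ => y ^ 2 + p) ⁻¹' Fᶜ) => (e : ℂ) ^ 2 + p) ⁻¹' N') := by
  intro N hN
  obtain ⟨r₀, hr₀, hr₀F⟩ := exists_ball_inter_subset hF p
  obtain ⟨ε, hε, hεN⟩ := Metric.mem_nhdsWithin_iff.mp hN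
  set r := min ε r₀ with hr
  have hrpos : 0 < r := lt_min hε hr₀
  refine ⟨ball p r ∩ {p}ᶜ, inter_mem (mem_nhdsWithin_of_mem_nhds (ball_mem_nhds p hrpos))
    self_mem_nhdsWithin, fun z hz => hεN ⟨ball_subset_ball (min_le_left _ _) hz.1, hz.2⟩, ?_⟩
  -- the preimage is the punctured disc of radius `√r`
  set A : Set ℂ := {y : ℂ | 0 < ‖y‖ ∧ ‖y‖ < Real.sqrt r} with hA
  have hAE : A ⊆ (fun y : ℂ => y ^ 2 + p) ⁻¹' Fᶜ := by
    intro y hy hyF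
    have hyb : y ^ 2 + p ∈ ball p r₀ := by
      rw [mem_ball, dist_eq_norm, norm_sq_add_sub]
      have : ‖y‖ ^ 2 < r := by
        rw [← Real.sq_sqrt hrpos.le]; exact pow_lt_pow_left₀ hy.2 (norm_nonneg _) two_ne_zero
      exact this.trans_le (min_le_right _ _)
    have hne : y ^ 2 + p ≠ p := by
      intro h
      have : y ^ 2 = 0 := by linear_combination h
      exact (ne_of_gt hy.1) (by rw [pow_eq_zero_iff two_ne_zero] at this; rw [this, norm_zero])
    exact hr₀F _ hyb hne hyF
  have heq : (fun e : ↥((fun y : ℂ => y ^ 2 + p) ⁻¹' Fᶜ) => (e : ℂ) ^ 2 + p) ⁻¹' (ball p r ∩ {p}ᶜ) =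
      Subtype.val ⁻¹' A := by
    ext e
    simp only [mem_preimage, mem_inter_iff, mem_ball, dist_eq_norm, norm_sq_add_sub, mem_compl_iff,
      mem_singleton_iff, hA, mem_setOf_eq]
    constructor
    · rintro ⟨h1, h2⟩
      have hne : (e : ℂ) ≠ 0 := fun h => h2 (by rw [h]; ring)
      refine ⟨norm_pos_iff.mpr hne, ?_⟩
      rw [← Real.sqrt_sq (norm_nonneg (e : ℂ))]
      exact Real.sqrt_lt_sqrt (sq_nonneg _) h1
    · rintro ⟨h1, h2⟩
      refine ⟨?_, fun h => ?_⟩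
      · rw [← Real.sq_sqrt hrpos.le]; exact pow_lt_pow_left₀ h2 (norm_nonneg _) two_ne_zero
      · have : (e : ℂ) ^ 2 = 0 := by linear_combination h
        rw [pow_eq_zero_iff two_ne_zero] at this
        exact (ne_of_gt h1) (by rw [this, norm_zero])
  rw [heq, isConnected_preimage_val_iff hAE]
  exact isConnected_puncturedBall (Real.sqrt_pos.mpr hrpos)

include hF in
/-- **The double cover `E_p → ℂ ∖ F` is ODD at `∞`**: every neighbourhood of `∞` contains the exterior
of a closed disc around `p` containing `F`, whose preimage `{y | √R < ‖y‖}` is connected.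
[cite: HatcherAT2002, §1.3 p.61] -/
theorem odd_sqAddCover_cocompact : ∀ N ∈ cocompact ℂ, ∃ N' ∈ cocompact ℂ, N' ⊆ N ∧
    IsConnected ((fun e : ↥((fun y : ℂ => y ^ 2 + p) ⁻¹' Fᶜ) => (e : ℂ) ^ 2 + p) ⁻¹' N') := by
  intro N hN
  rw [← cobounded_eq_cocompact] at hN
  obtain ⟨R, -, hRN⟩ := (hasBasis_cobounded_compl_closedBall p).mem_iff.mp hN
  obtain ⟨R', hR'⟩ := hF.isBounded.subset_closedBall p
  set R₁ := max (max R R') 0 with hR₁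
  have hR₁0 : 0 ≤ R₁ := le_max_right _ _
  refine ⟨(closedBall p R₁)ᶜ, (isCompact_closedBall p R₁).compl_mem_cocompact,
    (compl_subset_compl.mpr (closedBall_subset_closedBall
      ((le_max_left _ _).trans (le_max_left _ _)))).trans hRN, ?_⟩
  set A : Set ℂ := {y : ℂ | Real.sqrt R₁ < ‖y‖} with hA
  have hAE : A ⊆ (fun y : ℂ => y ^ 2 + p) ⁻¹' Fᶜ := by
    intro y hy hyF
    have h1 : y ^ 2 + p ∈ closedBall p R₁ :=
      closedBall_subset_closedBall ((le_max_right _ _).trans (le_max_left _ _)) (hR' hyF)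
    rw [mem_closedBall, dist_eq_norm, norm_sq_add_sub] at h1
    have h2 : R₁ < ‖y‖ ^ 2 := by
      rw [← Real.sq_sqrt hR₁0]; exact pow_lt_pow_left₀ hy (Real.sqrt_nonneg _) two_ne_zero
    exact absurd h1 (not_le.mpr h2)
  have heq : (fun e : ↥((fun y : ℂ => y ^ 2 + p) ⁻¹' Fᶜ) => (e : ℂ) ^ 2 + p) ⁻¹' (closedBall p R₁)ᶜ =
      Subtype.val ⁻¹' A := by
    ext e
    simp only [mem_preimage, mem_compl_iff, mem_closedBall, dist_eq_norm, norm_sq_add_sub, not_le, hA,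
      mem_setOf_eq]
    constructor
    · intro h
      rw [← Real.sqrt_sq (norm_nonneg (e : ℂ))]
      exact Real.sqrt_lt_sqrt hR₁0 h
    · intro h
      rw [← Real.sq_sqrt hR₁0]; exact pow_lt_pow_left₀ h (Real.sqrt_nonneg _) two_ne_zero
  rw [heq, isConnected_preimage_val_iff hAE]
  exact Literature.Topology.PlaneTopology.isConnected_setOf_lt_norm (Real.sqrt_nonneg _)

/-- Algebra of the splitting: if `‖u² - 1‖ < 1` then `Re u ≠ 0` (for `Re u = 0`, `u² = -(Im u)² ≤ 0`).
[folklore] -/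
private theorem re_ne_zero_of_norm_sq_sub_one_lt {u : ℂ} (hu : ‖u ^ 2 - 1‖ < 1) : u.re ≠ 0 := by
  intro h
  set t := u.im with ht
  have hu' : u = (t : ℂ) * I := Complex.ext (by simp [h]) (by simp [ht])
  have h2 : u ^ 2 - 1 = -(((t ^ 2 + 1 : ℝ)) : ℂ) := by
    rw [hu', mul_pow, Complex.I_sq]; push_cast; ring
  rw [h2, norm_neg, Complex.norm_real, Real.norm_eq_abs, abs_of_pos (by positivity)] at hu
  nlinarith [sq_nonneg t]

include hF in
/-- **The double cover `E_p → ℂ ∖ F` is NOT odd at any point `q ≠ p`** (in particular at the punctures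
`q ∈ F ∖ {p}`): for a small punctured disc `D*(q, r)` and any punctured neighbourhood `N' ⊆ D*(q, r)` of
`q`, the preimage of `N'` is disconnected — with `w² = q - p`, it lies in `{Re(y/w) ≠ 0}`, and both signs
occur (at `±√(z - p)` for `z ∈ N'`). [cite: HatcherAT2002, §1.3 p.61] -/
theorem not_odd_sqAddCover_nhdsNE_of_ne {q : ℂ} (hqp : q ≠ p) :
    ¬ ∀ N ∈ 𝓝[≠] q, ∃ N' ∈ 𝓝[≠] q, N' ⊆ N ∧
      IsConnected ((fun e : ↥((fun y : ℂ => y ^ 2 + p) ⁻¹' Fᶜ) => (e : ℂ) ^ 2 + p) ⁻¹' N') := by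
  intro hodd
  set c : ℂ := q - p with hc
  have hc0 : c ≠ 0 := sub_ne_zero.mpr hqp
  -- a square root `w` of `c`
  set w : ℂ := c ^ ((2 : ℕ)⁻¹ : ℂ) with hw
  have hw2 : w ^ 2 = c := Complex.cpow_nat_inv_pow c two_ne_zero
  have hw0 : w ≠ 0 := fun h => hc0 (by rw [← hw2, h]; ring)
  -- a small punctured disc around `q`, meeting `F` only in `q`, of radius `≤ ‖c‖`
  obtain ⟨r₀, hr₀, hr₀F⟩ := exists_ball_inter_subset hF q
  set r := min r₀ ‖c‖ with hr
  have hrpos : 0 < r := lt_min hr₀ (norm_pos_iff.mpr hc0)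
  obtain ⟨N', hN', hN'N, hconn⟩ := hodd (ball q r ∩ {q}ᶜ)
    (inter_mem (mem_nhdsWithin_of_mem_nhds (ball_mem_nhds q hrpos)) self_mem_nhdsWithin)
  -- the two open halves
  set P : ↥((fun y : ℂ => y ^ 2 + p) ⁻¹' Fᶜ) → ℂ := fun e => (e : ℂ) ^ 2 + p with hP
  set Up : Set ↥((fun y : ℂ => y ^ 2 + p) ⁻¹' Fᶜ) := {e | 0 < ((e : ℂ) / w).re} with hUp
  set Um : Set ↥((fun y : ℂ => y ^ 2 + p) ⁻¹' Fᶜ) := {e | ((e : ℂ) / w).re < 0} with hUm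
  have hcont : Continuous fun e : ↥((fun y : ℂ => y ^ 2 + p) ⁻¹' Fᶜ) => ((e : ℂ) / w).re :=
    Complex.continuous_re.comp (continuous_subtype_val.div_const w)
  have hUpo : IsOpen Up := isOpen_lt continuous_const hcont
  have hUmo : IsOpen Um := isOpen_lt hcont continuous_const
  -- the preimage of `N'` lies in `Up ∪ Um`
  have hre : ∀ e, P e ∈ N' → ((e : ℂ) / w).re ≠ 0 := by
    intro e he
    have hz := hN'N he
    rw [mem_inter_iff, mem_ball, dist_eq_norm] at hz
    have h1 : ‖((e : ℂ) / w) ^ 2 - 1‖ < 1 := by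
      have h2 : ((e : ℂ) / w) ^ 2 - 1 = ((e : ℂ) ^ 2 + p - q) / c := by
        rw [div_pow, hw2]; field_simp; ring
      rw [h2, norm_div, div_lt_one (norm_pos_iff.mpr hc0)]
      exact hz.1.trans_le (min_le_right _ _)
    exact re_ne_zero_of_norm_sq_sub_one_lt h1
  have hsub : P ⁻¹' N' ⊆ Up ∪ Um := fun e he => by
    rcases lt_trichotomy 0 ((e : ℂ) / w).re with h | h | h
    · exact Or.inl h
    · exact absurd h.symm (hre e he)
    · exact Or.inr h
  -- both halves meet the preimage: take `z ∈ N'` and its two square roots `±y`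
  haveI : (𝓝[≠] q).NeBot := NormedField.nhdsNE_neBot q
  obtain ⟨z, hzN'⟩ := Filter.nonempty_of_mem hN'
  have hz := hN'N hzN'
  have hzF : z ∉ F := hr₀F z (ball_subset_ball (min_le_left _ _) hz.1) hz.2
  set y : ℂ := (z - p) ^ ((2 : ℕ)⁻¹ : ℂ) with hy
  have hy2 : y ^ 2 = z - p := Complex.cpow_nat_inv_pow _ two_ne_zero
  have hyE : y ^ 2 + p ∈ Fᶜ := by rw [hy2, sub_add_cancel]; exact hzF
  have hyE' : (-y) ^ 2 + p ∈ Fᶜ := by rw [neg_sq]; exact hyE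
  have hPy : P ⟨y, hyE⟩ = z := by simp only [hP, hy2, sub_add_cancel]
  have hPy' : P ⟨-y, hyE'⟩ = z := by simp only [hP, neg_sq, hy2, sub_add_cancel]
  have hmem : (⟨y, hyE⟩ : ↥((fun y : ℂ => y ^ 2 + p) ⁻¹' Fᶜ)) ∈ P ⁻¹' N' := by
    show P ⟨y, hyE⟩ ∈ N'; rw [hPy]; exact hzN'
  have hmem' : (⟨-y, hyE'⟩ : ↥((fun y : ℂ => y ^ 2 + p) ⁻¹' Fᶜ)) ∈ P ⁻¹' N' := by
    show P ⟨-y, hyE'⟩ ∈ N'; rw [hPy']; exact hzN'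
  have hyre : (y / w).re ≠ 0 := hre ⟨y, hyE⟩ hmem
  have hneg : ((-y) / w).re = -(y / w).re := by rw [neg_div, Complex.neg_re]
  -- contradiction with connectedness
  have key := hconn.isPreconnected Up Um hUpo hUmo hsub
  rcases lt_or_gt_of_ne hyre with h | h
  · obtain ⟨e, -, he1, he2⟩ := key ⟨⟨-y, hyE'⟩, hmem', show 0 < ((-y) / w).re by rw [hneg]; linarith⟩
      ⟨⟨y, hyE⟩, hmem, h⟩
    have h1 : 0 < ((e : ℂ) / w).re := he1
    have h2 : ((e : ℂ) / w).re < 0 := he2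
    exact absurd h2 (lt_asymm h1)
  · obtain ⟨e, -, he1, he2⟩ := key ⟨⟨y, hyE⟩, hmem, h⟩
      ⟨⟨-y, hyE'⟩, hmem', show ((-y) / w).re < 0 by rw [hneg]; linarith⟩
    have h1 : 0 < ((e : ℂ) / w).re := he1
    have h2 : ((e : ℂ) / w).re < 0 := he2
    exact absurd h2 (lt_asymm h1)

end SqAdd

end PuncturedPlane

end Literature.Analysis.Complex

end
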